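import Literature.Geometry.Manifold.InverseFunctionTheorem
import Mathlib.Analysis.InnerProductSpace.Dual
import Mathlib.Analysis.InnerProductSpace.Calculus
import HarnessLib

/-!
# Straightening a regular level set: local coordinates in which a function is linear

Topic `Analysis/Calculus`. Theorem file (no definitions, no named facts; everything proved). The
Euclidean half of the "slice chart" / boundary-flattening construction (J. M. Lee, *Introduction to
Smooth Manifolds*, 2nd ed. (2013), Thm. 5.12 and the proof of Thm. 4.12 (rank theorem, the case of
a submersion onto `ℝ`); L. C. Evans, *PDE*, §C.1 "straightening the boundary"): on a real inner
product space `H`, let `s` be `C^∞` on an open set `V ∋ z` with `s z = 0` and derivative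
`Ds(z) = ⟪ν, ·⟫`, `ν ≠ 0`. Then the map

`Ψ y = y + (s y - ⟪ν, y - z⟫) • v`, `v = ‖ν‖⁻² ν`,

fixes `z`, has `DΨ(z) = id`, and satisfies `⟪Ψ y - z, ν⟫ = s y` identically; restricted to a
neighbourhood of `z` it is a `C^∞` diffeomorphism onto an open set (inverse function theorem). In
the coordinates `w = Ψ y` the function `s` is the linear function `⟪w - z, ν⟫`, its zero set is the
hyperplane through `z` orthogonal to `ν` and `{s < 0}` is the open half-space `{⟪w - z, ν⟫ < 0}`.

* `exists_straightening` — the statement, packaged as an `OpenPartialHomeomorph` of `H` with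
  `C^∞` forward and inverse maps and an invertible derivative at every point of the source.

Used for the boundary charts of regular sublevel domains `{σ < 0}` of a manifold
(`Geometry/Riemannian/BoundaryFlatteningChart.lean`), on the discharge path of
`Literature.Geometry.Riemannian.sharpLogSobolevAVR_four`.

## References

* J. M. Lee, *Introduction to Smooth Manifolds*, 2nd ed., GTM 218 (2013), Thm. 4.12, Thm. 5.12.
  [LeeSmoothManifolds2013]
* L. C. Evans, *Partial Differential Equations*, 2nd ed. (2010), Appendix C.1. [Evans2010]
-/

noncomputable section

open Set Function Filter Topology InnerProductSpace
open scoped RealInnerProductSpace ContDiff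

namespace Literature.Analysis.Calculus

open Literature.Geometry.Manifold

variable {H : Type*} [NormedAddCommGroup H] [InnerProductSpace ℝ H] [CompleteSpace H]

omit [CompleteSpace H] in
/-- The straightening map `Ψ y = y + (s y - ⟪ν, y - z⟫) • v` with `⟪v, ν⟫ = 1` satisfies
`⟪Ψ y - z, ν⟫ = s y`. [folklore] -/
theorem inner_straighten_sub (s : H → ℝ) (z ν v : H) (hv : ⟪v, ν⟫ = 1) (y : H) :
    ⟪(y + (s y - ⟪ν, y - z⟫) • v) - z, ν⟫ = s y := by
  rw [show y + (s y - ⟪ν, y - z⟫) • v - z = (y - z) + (s y - ⟪ν, y - z⟫) • v by abel,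
    inner_add_left, real_inner_smul_left, hv, mul_one, real_inner_comm (y - z) ν]
  ring

/-- **Straightening a regular level set** (Lee 2013, Thm. 5.12; Evans, §C.1). Let `s` be `C^∞` on
an open `V ∋ z` with `s z = 0` and `Ds(z) = ⟪ν, ·⟫`, `ν ≠ 0`. There is a `C^∞` local diffeomorphism
`Ψ` of `H` (an `OpenPartialHomeomorph` with `C^∞` inverse and invertible derivative on its source),
defined near `z`, with `Ψ z = z`, source inside `V`, and `⟪Ψ y - z, ν⟫ = s y` on the source: in
the new coordinates `s` is linear. [cite: LeeSmoothManifolds2013, Thm. 5.12] -/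
theorem exists_straightening {V : Set H} (hV : IsOpen V) {s : H → ℝ} (hs : ContDiffOn ℝ ∞ s V)
    {z : H} (hz : z ∈ V) (hs0 : s z = 0) {ν : H} (hν : ν ≠ 0)
    (hds : HasFDerivAt s (innerSL ℝ ν) z) :
    ∃ Ψ : OpenPartialHomeomorph H H, z ∈ Ψ.source ∧ Ψ.source ⊆ V ∧ Ψ z = z ∧
      ContDiffOn ℝ ∞ Ψ Ψ.source ∧ ContDiffOn ℝ ∞ Ψ.symm Ψ.target ∧
      (∀ y ∈ Ψ.source, ⟪Ψ y - z, ν⟫ = s y) ∧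
      (∀ y ∈ Ψ.source, ∃ L : H ≃L[ℝ] H, HasFDerivAt Ψ (L : H →L[ℝ] H) y) := by
  -- the vector `v` with `⟪v, ν⟫ = 1`
  set v : H := (‖ν‖ ^ 2)⁻¹ • ν with hv_def
  have hν2 : ‖ν‖ ^ 2 ≠ 0 := pow_ne_zero 2 (norm_ne_zero_iff.2 hν)
  have hv : ⟪v, ν⟫ = 1 := by
    rw [hv_def, real_inner_smul_left, real_inner_self_eq_norm_sq, inv_mul_cancel₀ hν2]
  -- the map
  set f : H → H := fun y => y + (s y - ⟪ν, y - z⟫) • v with hf_def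
  have hlin : ContDiff ℝ ∞ fun y : H => ⟪ν, y - z⟫ :=
    contDiff_const.inner ℝ (contDiff_id.sub contDiff_const)
  have hfV : ContDiffOn ℝ ∞ f V :=
    contDiffOn_id.add ((hs.sub hlin.contDiffOn).smul contDiffOn_const)
  have hfz : f z = z := by
    simp only [hf_def, hs0, sub_self, inner_zero_right, zero_smul, add_zero]
  -- the derivative at `z` is the identity
  have hdlin : HasFDerivAt (fun y : H => ⟪ν, y - z⟫) (innerSL ℝ ν) z := by
    have h1 : HasFDerivAt (fun y : H => y - z) (ContinuousLinearMap.id ℝ H) z :=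
      (hasFDerivAt_id z).sub_const z
    exact (innerSL ℝ ν).hasFDerivAt.comp z h1
  have hfd : HasFDerivAt f ((ContinuousLinearEquiv.refl ℝ H : H ≃L[ℝ] H) : H →L[ℝ] H) z := by
    have h := (hasFDerivAt_id z).add ((hds.sub hdlin).smul_const v)
    simp only [sub_self, ContinuousLinearMap.zero_smulRight, add_zero] at h
    exact h
  -- shrink `V` to where the derivative of `f` is invertible
  set W : Set H := V ∩ (fderiv ℝ f) ⁻¹' range ((↑) : (H ≃L[ℝ] H) → H →L[ℝ] H) with hW
  have hWo : IsOpen W :=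
    (hfV.continuousOn_fderiv_of_isOpen hV (by simp)).isOpen_inter_preimage hV
      ContinuousLinearEquiv.isOpen
  have hzW : z ∈ W := ⟨hz, ⟨ContinuousLinearEquiv.refl ℝ H, hfd.fderiv.symm⟩⟩
  -- the inverse function theorem at `z`, restricted to `W`
  have hfa : ContDiffAt ℝ ∞ f z := hfV.contDiffAt (hV.mem_nhds hz)
  have hn : (∞ : ℕ∞ω) ≠ 0 := by simp
  set D₀ := hfa.toOpenPartialHomeomorph f hfd hn with hD₀
  set D := D₀.restrOpen W hWo with hD
  have hDf : ∀ y, D y = f y := fun y => rfl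
  have hDsrc : D.source = D₀.source ∩ W := D₀.restrOpen_source W hWo
  have hDW : D.source ⊆ W := by rw [hDsrc]; exact inter_subset_right
  have hzD : z ∈ D.source := by
    rw [hDsrc]
    exact ⟨hfa.mem_toOpenPartialHomeomorph_source hfd hn, hzW⟩
  have hDs : ContDiffOn ℝ ∞ D D.source :=
    (hfV.mono fun y hy => (hDW hy).1).congr fun y _ => hDf y
  have hderiv : ∀ y ∈ D.source, ∃ L : H ≃L[ℝ] H, HasFDerivAt f (L : H →L[ℝ] H) y := fun y hy => by
    obtain ⟨e, he⟩ := (hDW hy).2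
    refine ⟨e, ?_⟩
    rw [he]
    exact ((hfV.differentiableOn (by simp) y (hDW hy).1).differentiableAt
      (hV.mem_nhds (hDW hy).1)).hasFDerivAt
  have hDs' : ContDiffOn ℝ ∞ D.symm D.target :=
    contDiffOn_symm_of_forall_hasFDerivAt_equiv D (fun y _ => hDf y) hn
      (fun y hy => hfV.contDiffAt (hV.mem_nhds (hDW hy).1)) hderiv
  refine ⟨D, hzD, fun y hy => (hDW hy).1, by rw [hDf, hfz], hDs, hDs', fun y _ => ?_,
    fun y hy => ?_⟩
  · rw [hDf]
    exact inner_straighten_sub s z ν v hv y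
  · obtain ⟨L, hL⟩ := hderiv y hy
    exact ⟨L, hL.congr_of_eventuallyEq (Eventually.of_forall fun y => hDf y)⟩

omit [CompleteSpace H] in
/-- In straightened coordinates the sublevel set is a half-space: with `Ψ` as in
`exists_straightening`, for `y ∈ Ψ.source`, `s y < 0 ↔ ⟪Ψ y - z, ν⟫ < 0` and
`s y = 0 ↔ ⟪Ψ y - z, ν⟫ = 0`. [folklore] -/
theorem straightening_sublevel_iff {Ψ : OpenPartialHomeomorph H H} {s : H → ℝ} {z ν : H}
    (hΨ : ∀ y ∈ Ψ.source, ⟪Ψ y - z, ν⟫ = s y) {y : H} (hy : y ∈ Ψ.source) :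
    (s y < 0 ↔ ⟪Ψ y - z, ν⟫ < 0) ∧ (s y = 0 ↔ ⟪Ψ y - z, ν⟫ = 0) := by
  rw [hΨ y hy]; exact ⟨Iff.rfl, Iff.rfl⟩

omit [CompleteSpace H] in
/-- The image of the sublevel set under the straightening map: for `T ⊆ Ψ.target`,
`Ψ.symm ⁻¹' {s < 0} ∩ T = {w | ⟪w - z, ν⟫ < 0} ∩ T`, i.e. `s (Ψ.symm w) < 0 ↔ ⟪w - z, ν⟫ < 0` for
`w ∈ Ψ.target`. [folklore] -/
theorem straightening_symm_sublevel_iff {Ψ : OpenPartialHomeomorph H H} {s : H → ℝ} {z ν : H}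
    (hΨ : ∀ y ∈ Ψ.source, ⟪Ψ y - z, ν⟫ = s y) {w : H} (hw : w ∈ Ψ.target) :
    (s (Ψ.symm w) < 0 ↔ ⟪w - z, ν⟫ < 0) ∧ (s (Ψ.symm w) = 0 ↔ ⟪w - z, ν⟫ = 0) ∧
      (s (Ψ.symm w) ≤ 0 ↔ ⟪w - z, ν⟫ ≤ 0) := by
  have h := hΨ (Ψ.symm w) (Ψ.map_target hw)
  rw [Ψ.right_inv hw] at h
  rw [← h]
  exact ⟨Iff.rfl, Iff.rfl, Iff.rfl⟩

end Literature.Analysis.Calculus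

end
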